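import Mathlib
import Literature.Analysis.FluidPDE.HardSphereCollisionRecord
import Literature.Analysis.FluidPDE.HardSpherePreCollisionSigma
import Literature.Analysis.FluidPDE.HardSphereRegularGeometry
import Literature.Analysis.FluidPDE.HardSphereFreeStretch
import Literature.MathematicalPhysics.KineticTheory.CollisionTubePullbackFlight
import HarnessLib

/-!
# `OneFlightGossipEngine.OneFlightLayeredChaos` — the recorded incoming velocities are the flight-start velocities
(crux stmt-AtomisticToContinuum-14535, line `Sketch`, registered stub `stub_preVel_eq_flightStart_vel`)

Along a hard-sphere flow on `𝕋^d` (`0 < ε < 1/2`), on the good set and on the window event, the pre-collisional velocities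
recorded at the `n`-th collision of `i` (partner `j = Φ.nthPartnerOf i n z`) are the exact velocities of `i`, resp. `j`, in
the configurations logged by `HardSphereFlow.coarsePastOf` at the two flight starts: a particle's velocity does not change
while it does not participate in a collision, and the record's `preVel` is the left limit at the collision time.

Route. (a) The window count makes the `n`-th collision time `t_n` of `i` genuine
(`HardSphereFlow.le_encard_collisionTimesOf_of_le_ncard`, `IsHardSphereTrajectory.nthCollisionTimeOf_enum_of_encard`):
`0 < t_n`, `i` participates at `t_n`, and — the torus geometry being regular for `ε < 1/2`
(`Torus.isHardSphereRegular_geometry`, `swap_mem_contactPairs_iff`) — `(i, j)` is an ordered contact pair. (b) The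
recorded pre-collisional velocities are the left-limit velocities (`IsHardSphereTrajectory.ofConfig_preVel_eq_leftLim`).
(c) A particle `k` taking part in no collision during the open interval `(a, b)` keeps its velocity on `[a, b)` (it flies
freely across the collisions of the other particles, `apply_eq_translate_of_forall_not_participates`), so its left-limit
velocity at `b` is `v_k(a)` (left limits exist, `IsHardSphereTrajectory.tendsto_leftLim`, and are unique in `ℝ^d`).
(d) Between its flight start `s_k` and `t_n` particle `k ∈ {i, j}` does not collide
(`IsHardSphereTrajectory.not_participates_of_mem_Ioo_flightStart`, `flightStart_lt`). No new definitions.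
-/

open MeasureTheory Set Filter Topology Function
open Literature.Analysis.FluidPDE

namespace Summit.AtomisticToContinuum.HydrodynamicLimit.Theorems

/-- **Velocities of a particle with no collision in `(a, b)` are constant on `[a, b)`** (hard-sphere trajectory over a
Hausdorff position space with continuous translations): `v_k(t) = v_k(a)` for `t ∈ [a, b)`. [folklore] -/
theorem vel_eq_of_forall_not_participates {d : Type*} [Fintype d] {X : Type*} [TopologicalSpace X] [T2Space X]
    {N : ℕ} {G : Geometry d X} {ε : ℝ} {γ : ℝ → Config N d X} (h : IsHardSphereTrajectory G ε N γ)
    (hG : ∀ x : X, Continuous (G.translate x)) (k : Fin N) {a b : ℝ}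
    (hk : ∀ u ∈ Ioo a b, ¬ Participates G ε (γ u) k) {t : ℝ} (ht : t ∈ Ico a b) :
    (γ t k).2 = (γ a k).2 := by
  rw [Literature.MathematicalPhysics.KineticTheory.apply_eq_translate_of_forall_not_participates h hG k ht.1
    fun u hu => hk u ⟨hu.1, hu.2.trans_lt ht.2⟩]

/-- **The left-limit velocity at `b` of a particle with no collision in `(a, b)` is its velocity at `a`** (`a < b`;
hard-sphere trajectory over a Hausdorff position space with continuous translations). The particle may well collide
at time `b` itself: only the open interval matters for the left limit. [folklore] -/
theorem leftLim_vel_eq_of_forall_not_participates {d : Type*} [Fintype d] {X : Type*} [TopologicalSpace X]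
    [T2Space X] {N : ℕ} {G : Geometry d X} {ε : ℝ} {γ : ℝ → Config N d X} (h : IsHardSphereTrajectory G ε N γ)
    (hG : ∀ x : X, Continuous (G.translate x)) (k : Fin N) {a b : ℝ} (hab : a < b)
    (hk : ∀ u ∈ Ioo a b, ¬ Participates G ε (γ u) k) :
    (Function.leftLim γ b k).2 = (γ a k).2 := by
  have hev : Continuous fun ζ : Config N d X => (ζ k).2 := (continuous_apply k).snd
  have h1 : Tendsto (fun u => (γ u k).2) (𝓝[<] b) (𝓝 (Function.leftLim γ b k).2) :=
    (hev.tendsto _).comp (h.tendsto_leftLim hG b)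
  have h2 : Tendsto (fun u => (γ u k).2) (𝓝[<] b) (𝓝 (γ a k).2) := by
    refine tendsto_const_nhds.congr' ?_
    filter_upwards [Ioo_mem_nhdsLT hab] with u hu
    rw [vel_eq_of_forall_not_participates h hG k hk ⟨hu.1.le, hu.2⟩]
  exact tendsto_nhds_unique h1 h2

/-- **The recorded incoming velocities are the flight-start velocities** (registered stub
`stub_preVel_eq_flightStart_vel` of crux stmt-AtomisticToContinuum-14535): on `Φ.good` and on the window event,
`(Φ.nthRecordOf i n z).preVel = (v_i(s_i), v_j(s_j))` where `s_i, s_j` are the flight starts of `i` and of its partner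
`j` logged by `Φ.coarsePastOf q i n z` (any coarse map `q`; velocities are kept exact). [folklore] -/
theorem stub_preVel_eq_flightStart_vel {d : Type*} [Fintype d] {N : ℕ} {ε : ℝ} (hε : 0 < ε) (hε2 : ε < 2⁻¹)
    (Φ : HardSphereFlow (Torus.geometry d) ε N) {C : Type*} (q : UnitAddTorus d → C) (i : Fin N) (n : ℕ) (w : ℝ)
    {z : Config N d (UnitAddTorus d)} (hz : z ∈ Φ.good)
    (hW : n + 1 ≤ Set.ncard (collisionTimesOf (Torus.geometry d) ε (fun t => Φ.flow t z) i ∩ Set.Ioc 0 w)) :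
    (Φ.nthRecordOf i n z).preVel =
      (((Φ.coarsePastOf q i n z).1 i).2, ((Φ.coarsePastOf q i n z).2 (Φ.nthPartnerOf i n z)).2) := by
  have _ := hε -- the positivity of `ε` (part of the registered signature) is not needed here
  have hn := Φ.le_encard_collisionTimesOf_of_le_ncard hW
  have htraj := Φ.isTrajectory z hz
  obtain ⟨hmem, -, -⟩ := htraj.nthCollisionTimeOf_enum_of_encard hn
  have hpart : Participates (Torus.geometry d) ε (Φ.flow (Φ.nthCollisionTimeOf i n z) z) i :=
    (hmem n le_rfl).1
  have hT0 : 0 < Φ.nthCollisionTimeOf i n z := (hmem n le_rfl).2.1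
  have hG := Torus.isHardSphereRegular_geometry (d := d) hε2
  have hp : (i, Φ.nthPartnerOf i n z) ∈
      contactPairs (Torus.geometry d) ε (Φ.flow (Φ.nthCollisionTimeOf i n z) z) := by
    rcases collide_partner hpart with h1 | h2
    · exact h1
    · exact (swap_mem_contactPairs_iff hG (p := (i, Φ.nthPartnerOf i n z))).1 h2
  have hpre := htraj.ofConfig_preVel_eq_leftLim (t := Φ.nthCollisionTimeOf i n z) hp
  rw [HardSphereFlow.nthRecordOf, hpre]
  simp only [HardSphereFlow.coarsePastOf, coarseConfig_apply]
  rw [leftLim_vel_eq_of_forall_not_participates htraj Torus.continuous_geometry_translate i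
      (flightStart_lt (htraj.finite_collisionTimesOf_inter_Ioo i 0 _) hT0)
      fun u hu => htraj.not_participates_of_mem_Ioo_flightStart hu,
    leftLim_vel_eq_of_forall_not_participates htraj Torus.continuous_geometry_translate (Φ.nthPartnerOf i n z)
      (flightStart_lt (htraj.finite_collisionTimesOf_inter_Ioo _ 0 _) hT0)
      fun u hu => htraj.not_participates_of_mem_Ioo_flightStart hu]

end Summit.AtomisticToContinuum.HydrodynamicLimit.Theorems
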